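/-
Copyright (c) 2026 the pub-hodgecm-mathlib formalisation cell (harness21).  Prover seat hodgecm-mathlib-LH4-p08 (g7), req620 Track A «(D-RAM) FOUR-FRAME» squad, helper lane
on h413 = stmt-HodgeConjecture-24833 (count-neutral).  STAGE-1b typed inventory (heir LEAD F0P3a-plan (g20) T19-24): row (3) near `1` for `Ad K`-invariant level-`M` pieces.
2026-09-04.
-/
import Literature.NumberTheory.Rogawski1990.LocalDeltaTransferLeviStratumPiece        -- ★ p858846 (this seat): `finsum_delta_mul_classOrbitalIntegral_mul_integral_eq_of_levi`
import Literature.NumberTheory.Rogawski1990.FinExplicitTransferFactorLeviStratumGerm  -- ★ p855542 (LH4-p07): `exists_nhds_one_forall_levi_valued_sub_one_le` (Levi eigenvalues are deep near `1`)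
import Literature.NumberTheory.Rogawski1990.UnitFundamentalLemmaInertLeviClause      -- ★ `isLocalGRegular_conj_iff`; brings ★ `isUnit_levi_of_isLocalGRegular_of_nonsplit` (UnitFundamentalLemmaInertLevi)
import Literature.NumberTheory.Automorphic.UnitaryGroupFormCongrFinSum               -- ★ `formCongr_one_eq` (the identity frame at `H′ = Φ₃`)
import HarnessLib

/-!
# Near `1 ∈ H_v`, on the LEVI population, the `Δ`-weighted class sums of two `Ad K`-invariant LEVEL-`M` pieces of `U(Φ₃)(L⁺_v)` are proportional in the ratio of
# their unipotent-fibre volumes — the row-(3) `G`-side for every STAGE-1b piece, division-free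
(Rogawski (1990), §4.9 Prop. 4.9.1 (b) p. 55 «if `γ ∈ M` … the `κ`-orbital integral is the ordinary orbital integral», Lemma 4.9.2 p. 56; §4.3 (4.3.1); §3.5 Prop. 3.5.2; Kottwitz (1986) §7)

Topic `NumberTheory/Rogawski1990`; namespace `Literature.NumberTheory.Rogawski1990`.  THEOREMS ONLY (no definition, no instance, no notation, no named fact, no `sorry`).
Cell `pub/hodgecm-mathlib`, crux H413 = `stmt-HodgeConjecture-24833`, Track A «(D-RAM) FOUR-FRAME», STAGE-1b typed inventory (heir LEAD F0P3a-plan (g20) T19-24; dealer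
LH4-plan (g12) board), seat LH4-p08 (g7).  HONEST LABEL: HC_CM is proved only modulo the 7 printed citations (2 remaining named inputs: hLiu418 = `stmt-HodgeConjecture-24832`,
h413 = `stmt-HodgeConjecture-24833`) until rung 0 closes; this file proves no letter and pays no registered stub.

THE POINT.  ★ p858846 `finsum_delta_mul_classOrbitalIntegral_mul_integral_eq_of_levi` gives, AT THE DIAGONAL LEVI REPRESENTATIVE `γ_H = (diag(d′₀, d′₁), u)`, the division-free
proportionality `(Σᶠ_c Δ(γ_H, c)·Φ(c, φ))·∫_N φ′∘e = (Σᶠ_c Δ(γ_H, c)·Φ(c, φ′))·∫_N φ∘e` for `φ, φ′` that are `Ad K`-invariant and left-invariant under the torus element `ι_v γ_H`.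
This file is the NEAR-`1` WRAPPER at the quasi-split form `H′ = Φ₃` (the carrier of the four-frame line), in the currency of the row predicate `PieceRowsWild` (★ DEFS №3) and of the
pieces' invariance clauses (★ `RankTransferWild` ∕ `PiecePropsWild`: `Ad K`-invariance under `K = cmLocalIntegralLevel`, left-invariance under the `ϖ_w`-adic level-`M` congruence
set `{u | ι_w u ≡ 1 mod ϖ^M}`): there is `V ∈ 𝓝 (1 : H_v)` such that for every `G`-regular `γ_H ∈ V` that is `H_v`-conjugate to a diagonal element,
`(Σᶠ_c Δ(γ_H, out c)·Φ(c, g))·∫_N g′(n) dμ_N = (Σᶠ_c Δ(γ_H, out c)·Φ(c, g′))·∫_N g(n) dμ_N` — for ANY local transfer factor `T` (a class function in `γ_H`: `conj_left`), ANY Haar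
`νG` and canonical `mG`, ANY Haar `μ_N` on `N(L⁺_v)`.  Ingredients, all ★: the identity frame `e₁ = cmDatumLocalCongr L v 1 _ _` (`e₁ u = u`, ★ `formCongr_one_eq`); near `1` the
eigenvalues `d′₀, u, d′₁` of `ι_v(yγ_Hy⁻¹)` satisfy `|d_k,w − 1| ≤ |ϖ^M|` (★ p855542 §1 at `c := ϖ^M`), so `ι_v(yγ_Hy⁻¹)` lies in the level-`M` set and the pieces' left-invariance
clause applies to it; the Levi units from `G`-regularity (★ `isUnit_levi_of_isLocalGRegular_of_nonsplit`); `T.conj_left` moves `yγ_Hy⁻¹ ↦ γ_H`.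
CONSUMER: row (3) of `stub_rows_transvPlus ∕ transvMinus ∕ regular` — `g := gselStar j …`, `g′ := 1_K = gselStar 0 …` (★ `piecePropsWild_*` supply `hK`, `hM` at `M = mstarFn`), then
★ p855650 (the anchor's row (3)) turns the right-hand side into `ρ_j · (νG₃(K)∕νH(K_H)) · Φ^st(γ_H, hFamily 0)` with `ρ_j = ∫_N g ∕ μ_N(N ∩ K)`.

* `exists_nhds_one_finsum_delta_mul_integral_eq_of_levi_of_level` — the statement above.

## References
* [Rogawski1990] J. D. Rogawski, *Automorphic Representations of Unitary Groups in Three Variables*, Ann. of Math. Stud. 123 (1990): §4.9 Prop. 4.9.1 (b) p. 55, Lemma 4.9.2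
  p. 56; §4.3 (4.3.1) p. 43; §3.5 Prop. 3.5.2 pp. 25–26; §4.13 Lemma 4.13.1 (a) p. 64.
* [Kottwitz1986] R. E. Kottwitz, *Base change for unit elements of Hecke algebras*, Compositio Math. 60 (1986): §7.
-/

set_option autoImplicit false

noncomputable section

open MeasureTheory Measure Set Filter Topology NumberField IsDedekindDomain Matrix
open Literature.NumberTheory.Automorphic Literature.NumberTheory.Automorphic.UnitaryGroup
open Literature.NumberTheory.GaloisRepresentations
open scoped NNReal ENNReal Matrix MatrixGroups

namespace Literature.NumberTheory.Rogawski1990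

set_option maxHeartbeats 1600000 in
-- instance-term unification on the CM local carriers (as in ★ `classOrbitalIntegral_eq_smul_integral_prod_of_torus_regular` ∕ ★ `U3SupercuspidalCoefficientSelberg`)
/-- **NEAR `1`, ON THE LEVI POPULATION, TWO `Ad K`-INVARIANT LEVEL-`M` PIECES HAVE PROPORTIONAL `Δ`-WEIGHTED CLASS SUMS, IN THE RATIO OF THEIR UNIPOTENT-FIBRE VOLUMES.**
At a non-split place `w ∣ v` of the quasi-split `U(Φ₃)`, for a uniformiser `ϖ` of `L_w`, a level `M : ℕ`, ANY Haar `νG`, a CANONICAL family `mG`, ANY Haar `μ_N` on `N(L⁺_v)` (s-finite)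
and ANY local transfer factor `T`: if `g, g′ : G → ℂ` are Borel, `Ad K`-invariant (`K = U(Φ₃)(𝒪_v)`) and left-invariant under the level-`M` congruence set (the clause of ★
`RankTransferWild` VERBATIM with `M L v w ↦ M`), then `∃ V ∈ 𝓝 1, ∀ γ_H ∈ V`, `H_v`-conjugate to a diagonal and `G`-regular,
`(Σᶠ_c T.Δ γ_H (out c)·Φ(c, g))·∫_N g′ = (Σᶠ_c T.Δ γ_H (out c)·Φ(c, g′))·∫_N g`. [cite: Rogawski1990, §4.9 Prop. 4.9.1 (b) p. 55, Lemma 4.9.2 p. 56; §4.3 (4.3.1) p. 43; §3.5 Prop. 3.5.2 pp. 25–26]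
[cite: Kottwitz1986, §7] -/
theorem exists_nhds_one_finsum_delta_mul_integral_eq_of_levi_of_level
    (L : Type) [Field L] [NumberField L] [IsCMField L]
    {v : HeightOneSpectrum (𝓞 ↥(maximalRealSubfield L))} (w : PlacesOver L v) (hw : IsCMField.complexConj L • w.1 = w.1)
    (ϖ : w.1.adicCompletion L) (hϖ : Valued.v ϖ = WithZero.exp (-1 : ℤ)) (M : ℕ)
    [MeasurableSpace ((cmDatum L 3 (Matrix.of fun i j : Fin 3 => if i.val + j.val + 1 = 3 then (1 : L) else 0)).Local v)] [BorelSpace ((cmDatum L 3 (Matrix.of fun i j : Fin 3 => if i.val + j.val + 1 = 3 then (1 : L) else 0)).Local v)]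
    [∀ γ : (cmDatum L 3 (Matrix.of fun i j : Fin 3 => if i.val + j.val + 1 = 3 then (1 : L) else 0)).Local v, MeasurableSpace (((cmDatum L 3 (Matrix.of fun i j : Fin 3 => if i.val + j.val + 1 = 3 then (1 : L) else 0)).Local v) ⧸ Subgroup.centralizer ({γ} : Set ((cmDatum L 3 (Matrix.of fun i j : Fin 3 => if i.val + j.val + 1 = 3 then (1 : L) else 0)).Local v)))]
    [∀ γ : (cmDatum L 3 (Matrix.of fun i j : Fin 3 => if i.val + j.val + 1 = 3 then (1 : L) else 0)).Local v, BorelSpace (((cmDatum L 3 (Matrix.of fun i j : Fin 3 => if i.val + j.val + 1 = 3 then (1 : L) else 0)).Local v) ⧸ Subgroup.centralizer ({γ} : Set ((cmDatum L 3 (Matrix.of fun i j : Fin 3 => if i.val + j.val + 1 = 3 then (1 : L) else 0)).Local v)))]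
    (νG : Measure ((cmDatum L 3 (Matrix.of fun i j : Fin 3 => if i.val + j.val + 1 = 3 then (1 : L) else 0)).Local v)) [νG.IsHaarMeasure] [νG.IsMulRightInvariant]
    {mG : OrbitalMeasureFamily ((cmDatum L 3 (Matrix.of fun i j : Fin 3 => if i.val + j.val + 1 = 3 then (1 : L) else 0)).Local v)}
    (hmG : mG.IsCanonical (fun γ => IsRegularElt (γ.val : GL (Fin 3) (UnitaryGroup.LocalRing L v))) νG)
    [MeasurableSpace ↥(unitaryGroupOfForm (conjLocal L (IsCMField.complexConj L) v) (cmLocalForm L 3 v))] [BorelSpace ↥(unitaryGroupOfForm (conjLocal L (IsCMField.complexConj L) v) (cmLocalForm L 3 v))]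
    (μN : Measure ↥(unipotentU (conjLocal L (IsCMField.complexConj L) v) (cmLocalForm L 3 v))) [μN.IsHaarMeasure] [SFinite μN]
    (T : LocalTransferFactor L (Matrix.of fun i j : Fin 3 => if i.val + j.val + 1 = 3 then (1 : L) else 0) v)
    {g g' : (cmDatum L 3 (Matrix.of fun i j : Fin 3 => if i.val + j.val + 1 = 3 then (1 : L) else 0)).Local v → ℂ} (hg : Measurable g) (hg' : Measurable g')
    (hK : ∀ u ∈ cmLocalIntegralLevel L 3 (Matrix.of fun i j : Fin 3 => if i.val + j.val + 1 = 3 then (1 : L) else 0) v, ∀ x, g (u * x * u⁻¹) = g x)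
    (hK' : ∀ u ∈ cmLocalIntegralLevel L 3 (Matrix.of fun i j : Fin 3 => if i.val + j.val + 1 = 3 then (1 : L) else 0) v, ∀ x, g' (u * x * u⁻¹) = g' x)
    (hM : (∀ u : (cmDatum L 3 (Matrix.of fun i j : Fin 3 => if i.val + j.val + 1 = 3 then (1 : L) else 0)).Local v,
        (∀ a b, Valued.v ((ϖ ^ M)⁻¹ * ((((localNonsplitEquiv (IsCMField.complexConj L) (Matrix.of fun i j : Fin 3 => if i.val + j.val + 1 = 3 then (1 : L) else 0) (IsCMField.complexConj_ne_one L) w hw u :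
            ↥(unitaryGroupOfForm (galAdicCompletionMap (L := L) (IsCMField.complexConj L) hw) (placeForm (Matrix.of fun i j : Fin 3 => if i.val + j.val + 1 = 3 then (1 : L) else 0) w.1))) : GL (Fin 3) (w.1.adicCompletion L)) :
              Matrix (Fin 3) (Fin 3) (w.1.adicCompletion L)) a b - (1 : Matrix (Fin 3) (Fin 3) (w.1.adicCompletion L)) a b)) ≤ 1) →
        ∀ x, g (u * x) = g x))
    (hM' : (∀ u : (cmDatum L 3 (Matrix.of fun i j : Fin 3 => if i.val + j.val + 1 = 3 then (1 : L) else 0)).Local v,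
        (∀ a b, Valued.v ((ϖ ^ M)⁻¹ * ((((localNonsplitEquiv (IsCMField.complexConj L) (Matrix.of fun i j : Fin 3 => if i.val + j.val + 1 = 3 then (1 : L) else 0) (IsCMField.complexConj_ne_one L) w hw u :
            ↥(unitaryGroupOfForm (galAdicCompletionMap (L := L) (IsCMField.complexConj L) hw) (placeForm (Matrix.of fun i j : Fin 3 => if i.val + j.val + 1 = 3 then (1 : L) else 0) w.1))) : GL (Fin 3) (w.1.adicCompletion L)) :
              Matrix (Fin 3) (Fin 3) (w.1.adicCompletion L)) a b - (1 : Matrix (Fin 3) (Fin 3) (w.1.adicCompletion L)) a b)) ≤ 1) →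
        ∀ x, g' (u * x) = g' x)) :
    ∃ V ∈ 𝓝 (1 : ((cmDatum L 2 (Matrix.of fun i j : Fin 2 => if i.val + j.val + 1 = 2 then (1 : L) else 0)).Local v ×
      (cmDatum L 1 (Matrix.of fun i j : Fin 1 => if i.val + j.val + 1 = 1 then (1 : L) else 0)).Local v)),
      ∀ γH ∈ V,
        (∃ (y : ((cmDatum L 2 (Matrix.of fun i j : Fin 2 => if i.val + j.val + 1 = 2 then (1 : L) else 0)).Local v ×
      (cmDatum L 1 (Matrix.of fun i j : Fin 1 => if i.val + j.val + 1 = 1 then (1 : L) else 0)).Local v)) (d' : Fin 2 → (UnitaryGroup.LocalRing L v)ˣ),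
            glDiagonal 2 (UnitaryGroup.LocalRing L v) d' = ((y * γH * y⁻¹).1.val : GL (Fin 2) (UnitaryGroup.LocalRing L v))) →
        IsLocalGRegular L v γH →
          (∑ᶠ c : ConjClasses ((cmDatum L 3 (Matrix.of fun i j : Fin 3 => if i.val + j.val + 1 = 3 then (1 : L) else 0)).Local v), T.Δ γH (Quotient.out c) * classOrbitalIntegral mG g c) *
              ∫ n : ↥(unipotentU (conjLocal L (IsCMField.complexConj L) v) (cmLocalForm L 3 v)), g' ((n : ↥(unitaryGroupOfForm (conjLocal L (IsCMField.complexConj L) v) (cmLocalForm L 3 v))) : (cmDatum L 3 (Matrix.of fun i j : Fin 3 => if i.val + j.val + 1 = 3 then (1 : L) else 0)).Local v) ∂μN =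
            (∑ᶠ c : ConjClasses ((cmDatum L 3 (Matrix.of fun i j : Fin 3 => if i.val + j.val + 1 = 3 then (1 : L) else 0)).Local v), T.Δ γH (Quotient.out c) * classOrbitalIntegral mG g' c) *
              ∫ n : ↥(unipotentU (conjLocal L (IsCMField.complexConj L) v) (cmLocalForm L 3 v)), g ((n : ↥(unitaryGroupOfForm (conjLocal L (IsCMField.complexConj L) v) (cmLocalForm L 3 v))) : (cmDatum L 3 (Matrix.of fun i j : Fin 3 => if i.val + j.val + 1 = 3 then (1 : L) else 0)).Local v) ∂μN := by
  have hc := IsCMField.complexConj_ne_one L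
  have hϖ0 : ϖ ≠ 0 := fun h0 => by rw [h0, map_zero] at hϖ; exact WithZero.zero_ne_coe hϖ
  have hϖM : ϖ ^ M ≠ 0 := pow_ne_zero M hϖ0
  -- near `1`: the eigenvalues of every Levi representative are `ϖ^M`-deep (★ p855542 §1)
  obtain ⟨V, hV, hdeep⟩ := exists_nhds_one_forall_levi_valued_sub_one_le L v w hϖM
  refine ⟨V, hV, fun γH hγ hlevi hreg => ?_⟩
  obtain ⟨y, d', hyd'⟩ := hlevi
  -- the Levi representative `γ₁ := y γ_H y⁻¹` and its three units
  have hreg₁ : IsLocalGRegular L v (y * γH * y⁻¹) := (isLocalGRegular_conj_iff L y γH).2 hreg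
  obtain ⟨ha, hb, h12⟩ := isUnit_levi_of_isLocalGRegular_of_nonsplit L w hw hyd' hreg₁
  have hι := endoEmbLocal_eq_glDiagonal_of_fst_eq L v (y * γH * y⁻¹) hyd'
  have hdk := hdeep γH hγ y _ hι
  -- the identity frame `e₁ = cmDatumLocalCongr L v 1 _ h1`, `e₁ u = u`
  have h1 : formCongr (conjLocal L (IsCMField.complexConj L) v) (1 : GL (Fin 3) (UnitaryGroup.LocalRing L v))
      (((Matrix.of fun i j : Fin 3 => if i.val + j.val + 1 = 3 then (1 : L) else 0)).map (algebraMap L (UnitaryGroup.LocalRing L v))) = (1 : UnitaryGroup.LocalRing L v) • ((Matrix.of fun i j : Fin 3 => if i.val + j.val + 1 = 3 then (1 : L) else 0)).map (algebraMap L (UnitaryGroup.LocalRing L v)) := by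
    rw [formCongr_one_eq, one_smul]
  have he : ∀ u : ↥(unitaryGroupOfForm (conjLocal L (IsCMField.complexConj L) v) (cmLocalForm L 3 v)), cmDatumLocalCongr L v (1 : GL (Fin 3) (UnitaryGroup.LocalRing L v)) isUnit_one h1 u = u := fun u => by
    apply Subtype.ext
    apply Units.ext
    change ((1 : GL (Fin 3) (UnitaryGroup.LocalRing L v)) * (u : GL (Fin 3) (UnitaryGroup.LocalRing L v)) * (1 : GL (Fin 3) (UnitaryGroup.LocalRing L v))⁻¹).val =
      (u : GL (Fin 3) (UnitaryGroup.LocalRing L v)).val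
    rw [inv_one, mul_one, one_mul]
  -- the level subgroup `K₃` read as a subgroup of the `unitaryGroupOfForm` spelling, and a Haar measure on it
  obtain ⟨K3, hK3⟩ : ∃ K3 : Subgroup ↥(unitaryGroupOfForm (conjLocal L (IsCMField.complexConj L) v) (cmLocalForm L 3 v)), K3 = cmLocalIntegralLevel L 3 (Matrix.of fun i j : Fin 3 => if i.val + j.val + 1 = 3 then (1 : L) else 0) v := ⟨_, rfl⟩
  have hKv : ∀ u : ↥(unitaryGroupOfForm (conjLocal L (IsCMField.complexConj L) v) (cmLocalForm L 3 v)), u ∈ K3 ↔ u ∈ cmLocalIntegralLevel L 3 (Matrix.of fun i j : Fin 3 => if i.val + j.val + 1 = 3 then (1 : L) else 0) v := fun u => by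
    rw [hK3]; exact Iff.rfl
  have hK3co : IsCompact (K3 : Set ↥(unitaryGroupOfForm (conjLocal L (IsCMField.complexConj L) v) (cmLocalForm L 3 v))) ∧ IsOpen (K3 : Set ↥(unitaryGroupOfForm (conjLocal L (IsCMField.complexConj L) v) (cmLocalForm L 3 v))) := by
    rw [hK3]; exact isCompact_isOpen_cmLocalIntegralLevel L 3 (Matrix.of fun i j : Fin 3 => if i.val + j.val + 1 = 3 then (1 : L) else 0) v
  haveI : LocallyCompactSpace ↥(unitaryGroupOfForm (conjLocal L (IsCMField.complexConj L) v) (cmLocalForm L 3 v)) := locallyCompactSpace_local (IsCMField.complexConj L) 3 _ v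
  haveI : LocallyCompactSpace ↥K3 := hK3co.1.isClosed.isClosedEmbedding_subtypeVal.locallyCompactSpace
  haveI : CompactSpace ↥K3 := isCompact_iff_compactSpace.1 hK3co.1
  obtain ⟨κ, hκ⟩ : ∃ κ : Measure ↥K3, κ.IsHaarMeasure := ⟨Measure.haar, inferInstance⟩
  -- the ι_v-image of the representative lies in the level-`M` set: its `w`-matrix is `diag(d_k,w)` with `|d_k,w − 1| ≤ |ϖ^M|`
  have hlev : ∀ a b, Valued.v ((ϖ ^ M)⁻¹ * ((((localNonsplitEquiv (IsCMField.complexConj L) (Matrix.of fun i j : Fin 3 => if i.val + j.val + 1 = 3 then (1 : L) else 0) (IsCMField.complexConj_ne_one L) w hw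
      (endoEmbLocal L v (y * γH * y⁻¹)) :
        ↥(unitaryGroupOfForm (galAdicCompletionMap (L := L) (IsCMField.complexConj L) hw) (placeForm (Matrix.of fun i j : Fin 3 => if i.val + j.val + 1 = 3 then (1 : L) else 0) w.1))) : GL (Fin 3) (w.1.adicCompletion L)) :
          Matrix (Fin 3) (Fin 3) (w.1.adicCompletion L)) a b - (1 : Matrix (Fin 3) (Fin 3) (w.1.adicCompletion L)) a b)) ≤ 1 := by
    have hmat : ((((localNonsplitEquiv (IsCMField.complexConj L) (Matrix.of fun i j : Fin 3 => if i.val + j.val + 1 = 3 then (1 : L) else 0) (IsCMField.complexConj_ne_one L) w hw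
        (endoEmbLocal L v (y * γH * y⁻¹)) :
          ↥(unitaryGroupOfForm (galAdicCompletionMap (L := L) (IsCMField.complexConj L) hw) (placeForm (Matrix.of fun i j : Fin 3 => if i.val + j.val + 1 = 3 then (1 : L) else 0) w.1))) : GL (Fin 3) (w.1.adicCompletion L)) :
            Matrix (Fin 3) (Fin 3) (w.1.adicCompletion L))) =
        Matrix.diagonal fun i => ((![d' 0, (isUnit_finGammaTwo L v (y * γH * y⁻¹)).unit, d' 1] i : (UnitaryGroup.LocalRing L v)ˣ) : UnitaryGroup.LocalRing L v) w := by
      rw [coe_coe_localNonsplitEquiv_apply, hι, coe_glDiagonal,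
        Matrix.diagonal_map (RingHom.map_zero (Pi.evalRingHom (fun w' : PlacesOver L v => w'.1.adicCompletion L) w))]
      rfl
    intro a b
    rw [hmat, Matrix.diagonal_apply, Matrix.one_apply]
    by_cases hab : a = b
    · rw [if_pos hab, if_pos hab, map_mul, map_inv₀, map_pow]
      have hk := hdk a
      rw [map_pow] at hk
      have hpos : 0 < Valued.v ϖ ^ M := pow_pos (by rw [hϖ]; exact WithZero.exp_pos) M
      calc (Valued.v ϖ ^ M)⁻¹ * Valued.v ((((![d' 0, (isUnit_finGammaTwo L v (y * γH * y⁻¹)).unit, d' 1] a : (UnitaryGroup.LocalRing L v)ˣ) :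
              UnitaryGroup.LocalRing L v) w) - 1)
          ≤ (Valued.v ϖ ^ M)⁻¹ * Valued.v ϖ ^ M := by gcongr
        _ = 1 := inv_mul_cancel₀ hpos.ne'
    · rw [if_neg hab, if_neg hab, sub_zero, mul_zero, map_zero]
      exact zero_le
  -- ★ p858846 at the representative, in the identity frame
  have key := finsum_delta_mul_classOrbitalIntegral_mul_integral_eq_of_levi L (Matrix.of fun i j : Fin 3 => if i.val + j.val + 1 = 3 then (1 : L) else 0) (antidiagOne_map_transpose (IsCMField.complexConj L) 3)
    (isUnit_antidiagOne_det L 3) w hw (1 : GL (Fin 3) (UnitaryGroup.LocalRing L v)) isUnit_one h1 νG hmG hKv κ μN T hyd' ha hb h12 hg hg'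
    (fun k x => by rw [he, he]; exact hK _ ((hKv k).1 k.2) _)
    (fun x => by rw [he, he]; exact hM _ hlev _)
    (fun k x => by rw [he, he]; exact hK' _ ((hKv k).1 k.2) _)
    (fun x => by rw [he, he]; exact hM' _ hlev _)
  simp only [he, T.conj_left] at key
  exact key

end Literature.NumberTheory.Rogawski1990

end
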